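import Mathlib
import HarnessLib

/-!
# The one-dimensional weighted Hardy inequality (Muckenhoupt 1972, `p = q = 2`)

For weights on an interval `(a, b)`, the inequality
`∫ₐᵇ (∫ₐˣ g)² ω(x) dx ≤ 4B · ∫ₐᵇ g²/v` holds as soon as `(∫ₓᵇ ω)(∫ₐˣ v) ≤ B` on `(a, b)`
(B. Muckenhoupt, *Hardy's inequality with weights*, Studia Math. 44 (1972) 31–38, Theorem 1, the
sufficiency half for `p = 2` with the sharp-order constant `4B`; statement also in
Drábek–Kufner–Nicolosi, *Quasilinear Elliptic Equations with Degenerations and Singularities*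
(de Gruyter 1997), Example 1.4 (1.34)–(1.37), and Opic–Kufner, *Hardy-type inequalities* (1990),
Thm. 1.14). The weight `ω` may be singular at the left end point `a` and the reciprocal weight `v`
may vanish there — the situation of singular Sturm–Liouville problems (e.g. the angular pencil
behind `Summit.NavierStokesRegularity.NavierStokesRegularity.Theorems.SwirlHolderTower.FunnelExponent`,
where `ω = v⁻¹ = e^{N sin²φ/4}/sin φ`): the lower bound `λ₁ ≥ 1/(4B)` for the bottom of the
spectrum of `-(w h')' = λ ω h` with `h(a) = 0` is exactly this inequality.

Main statement: `Literature.Analysis.Calculus.weightedHardy` (both sides as `∫⁻`, no integrability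
hypotheses; `v, g` continuous on `[a,b]`, `ω` continuous on `(a,b]`, `v, ω > 0` on `(a,b)`).
The helper lemmas (two fundamental-theorem-of-calculus evaluations with a singular end point, the
pointwise Cauchy–Schwarz step and the tail bound) are private. No definitions, no named facts.

## References
* B. Muckenhoupt, Studia Math. 44 (1972) 31–38, Thm. 1 (key `Muckenhoupt1972`).
* P. Drábek, A. Kufner, F. Nicolosi, de Gruyter 1997, Example 1.4 (key `DrabekKufnerNicolosi1997`).
-/

noncomputable section

open MeasureTheory Set intervalIntegral
open scoped ENNReal NNReal Topology

namespace Literature.Analysis.Calculus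


/-- A function continuous on `[a,b]` and positive on `(a,b)` is nonnegative on `[a,b]`. [folklore] -/
private theorem nonneg_of_pos_Ioo {a b : ℝ} (hab : a < b) {v : ℝ → ℝ} (hv : ContinuousOn v (Icc a b))
    (hv0 : ∀ t ∈ Ioo a b, 0 < v t) : ∀ t ∈ Icc a b, 0 ≤ v t := by
  intro t ht
  have hcl : t ∈ closure (Ioo a b) := by rw [closure_Ioo hab.ne]; exact ht
  exact ContinuousWithinAt.closure_le hcl continuousWithinAt_const
    ((hv t ht).mono Ioo_subset_Icc_self) fun y hy => (hv0 y hy).le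

/-- A function continuous on `(a,b]` and positive on `(a,b)` is nonnegative on `(a,b]`. [folklore] -/
private theorem nonneg_of_pos_Ioo' {a b : ℝ} (hab : a < b) {ω : ℝ → ℝ} (hω : ContinuousOn ω (Ioc a b))
    (hω0 : ∀ t ∈ Ioo a b, 0 < ω t) : ∀ t ∈ Ioc a b, 0 ≤ ω t := by
  intro t ht
  have hcl : t ∈ closure (Ioo a b) := by rw [closure_Ioo hab.ne]; exact ⟨ht.1.le, ht.2⟩
  exact ContinuousWithinAt.closure_le hcl continuousWithinAt_const
    ((hω t ht).mono Ioo_subset_Ioc_self) fun y hy => (hω0 y hy).le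

/-- FTC step at the left end: `∫_a^x v/√φ = 2√φ(x)` for `φ(t) = ∫_a^t v`, `v > 0` on `(a,b)`,
`v` continuous on `[a,b]`. Also gives integrability of the (possibly singular at `a`) integrand. [folklore] -/
private theorem ftc_left {a b : ℝ} {v : ℝ → ℝ} (hv : ContinuousOn v (Icc a b))
    (hv0 : ∀ t ∈ Ioo a b, 0 < v t) {x : ℝ} (hx : x ∈ Ioc a b) :
    IntegrableOn (fun t => v t / Real.sqrt (∫ s in a..t, v s)) (Ioc a x) volume ∧
      ∫ t in a..x, v t / Real.sqrt (∫ s in a..t, v s) = 2 * Real.sqrt (∫ s in a..x, v s) := by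
  set φ : ℝ → ℝ := fun t => ∫ s in a..t, v s with hφ
  have hax : a ≤ x := hx.1.le
  have hvx : ContinuousOn v (Icc a x) := hv.mono (Icc_subset_Icc_right hx.2)
  -- φ is continuous on [a, x]
  have hφcont : ContinuousOn φ (Icc a x) := by
    have hint : IntegrableOn v (uIcc a x) volume := by
      rw [uIcc_of_le hax]
      exact hvx.integrableOn_compact isCompact_Icc
    have := intervalIntegral.continuousOn_primitive_interval (μ := volume) hint
    rwa [uIcc_of_le hax] at this
  -- φ > 0 on (a, x]
  have hφpos : ∀ t ∈ Ioc a x, 0 < φ t := by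
    intro t ht
    have hat : a < t := ht.1
    show 0 < ∫ s in a..t, v s
    have hvt : ContinuousOn v (Icc a t) := hv.mono (Icc_subset_Icc_right (ht.2.trans hx.2))
    refine intervalIntegral.intervalIntegral_pos_of_pos_on
      (hvt.intervalIntegrable_of_Icc hat.le) (fun s hs => hv0 s ⟨hs.1, hs.2.trans_le (ht.2.trans hx.2)⟩) hat
  -- derivative of φ at interior points
  have hφderiv : ∀ t ∈ Ioo a x, HasDerivAt φ (v t) t := by
    intro t ht
    have htb : t ∈ Ioo a b := ⟨ht.1, ht.2.trans_le hx.2⟩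
    have hint : IntervalIntegrable v volume a t :=
      (hv.mono (Icc_subset_Icc_right htb.2.le)).intervalIntegrable_of_Icc ht.1.le
    have hmeas : StronglyMeasurableAtFilter v (𝓝 t) volume :=
      ContinuousOn.stronglyMeasurableAtFilter isOpen_Ioo (hv.mono Ioo_subset_Icc_self) t htb
    have hcont : ContinuousAt v t := (hv.mono Ioo_subset_Icc_self).continuousAt (isOpen_Ioo.mem_nhds htb)
    exact intervalIntegral.integral_hasDerivAt_right hint hmeas hcont
  -- F = 2√φ, its derivative
  set F : ℝ → ℝ := fun t => 2 * Real.sqrt (φ t) with hF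
  have hFcont : ContinuousOn F (Icc a x) :=
    continuousOn_const.mul (Real.continuous_sqrt.comp_continuousOn hφcont)
  have hFderiv : ∀ t ∈ Ioo a x, HasDerivAt F (v t / Real.sqrt (φ t)) t := by
    intro t ht
    have hpos : φ t ≠ 0 := (hφpos t ⟨ht.1, ht.2.le⟩).ne'
    have h1 : HasDerivAt (fun y => Real.sqrt (φ y)) (v t / (2 * Real.sqrt (φ t))) t :=
      (hφderiv t ht).sqrt hpos
    have h2 := h1.const_mul (2 : ℝ)
    have hsq : Real.sqrt (φ t) ≠ 0 := Real.sqrt_ne_zero'.mpr (hφpos t ⟨ht.1, ht.2.le⟩)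
    refine h2.congr_deriv ?_
    rw [← mul_div_assoc, mul_div_mul_left _ _ (two_ne_zero' ℝ)]
  have hnonneg : ∀ t ∈ Ioo a x, 0 ≤ v t / Real.sqrt (φ t) := fun t ht =>
    div_nonneg (hv0 t ⟨ht.1, ht.2.trans_le hx.2⟩).le (Real.sqrt_nonneg _)
  have hInt : IntegrableOn (fun t => v t / Real.sqrt (φ t)) (Ioc a x) volume :=
    intervalIntegral.integrableOn_deriv_of_nonneg hFcont hFderiv hnonneg
  refine ⟨hInt, ?_⟩
  have hII : IntervalIntegrable (fun t => v t / Real.sqrt (φ t)) volume a x :=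
    (intervalIntegrable_iff_integrableOn_Ioc_of_le hax).mpr hInt
  have := intervalIntegral.integral_eq_sub_of_hasDerivAt_of_le hax hFcont hFderiv hII
  rw [this]
  simp [hF, hφ, intervalIntegral.integral_same]


/-- FTC step at the right end: `∫_t^b ω/√W = 2√W(t)` for `W(x) = ∫_x^b ω`, `ω > 0` on `(a,b)`,
`ω` continuous on `(a,b]`, `a < t`. [folklore] -/
private theorem ftc_right {a b : ℝ} {ω : ℝ → ℝ} (hω : ContinuousOn ω (Ioc a b))
    (hω0 : ∀ x ∈ Ioo a b, 0 < ω x) {t : ℝ} (ht : t ∈ Ioo a b) :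
    IntegrableOn (fun x => ω x / Real.sqrt (∫ s in x..b, ω s)) (Ioc t b) volume ∧
      ∫ x in t..b, ω x / Real.sqrt (∫ s in x..b, ω s) = 2 * Real.sqrt (∫ s in t..b, ω s) := by
  set W : ℝ → ℝ := fun x => ∫ s in x..b, ω s with hW
  have htb : t ≤ b := ht.2.le
  have hωt : ContinuousOn ω (Icc t b) := hω.mono fun y hy => ⟨ht.1.trans_le hy.1, hy.2⟩
  -- W is continuous on [t, b]
  have hWcont : ContinuousOn W (Icc t b) := by
    have hint : IntegrableOn ω (uIcc b t) volume := by
      rw [uIcc_comm, uIcc_of_le htb]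
      exact hωt.integrableOn_compact isCompact_Icc
    have hc := intervalIntegral.continuousOn_primitive_interval (μ := volume) hint
    rw [uIcc_comm, uIcc_of_le htb] at hc
    -- hc : ContinuousOn (fun x => ∫ s in b..x, ω s) (Icc t b)
    have : W = fun x => -∫ s in b..x, ω s := by
      funext x; simp [hW, intervalIntegral.integral_symm b x]
    rw [this]
    exact hc.neg
  -- W > 0 on [t, b)
  have hWpos : ∀ x ∈ Ico t b, 0 < W x := by
    intro x hx
    show 0 < ∫ s in x..b, ω s
    have hωx : ContinuousOn ω (Icc x b) := hωt.mono (Icc_subset_Icc_left hx.1)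
    exact intervalIntegral.intervalIntegral_pos_of_pos_on (hωx.intervalIntegrable_of_Icc hx.2.le)
      (fun s hs => hω0 s ⟨(ht.1.trans_le hx.1).trans hs.1, hs.2⟩) hx.2
  -- derivative of W at interior points: W' = -ω
  have hWderiv : ∀ x ∈ Ioo t b, HasDerivAt W (-ω x) x := by
    intro x hx
    have hxab : x ∈ Ioo a b := ⟨ht.1.trans hx.1, hx.2⟩
    have hint : IntervalIntegrable ω volume x b :=
      (hωt.mono (Icc_subset_Icc_left hx.1.le)).intervalIntegrable_of_Icc hx.2.le
    have hmeas : StronglyMeasurableAtFilter ω (𝓝 x) volume :=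
      ContinuousOn.stronglyMeasurableAtFilter isOpen_Ioo (hω.mono Ioo_subset_Ioc_self) x hxab
    have hcont : ContinuousAt ω x :=
      (hω.mono Ioo_subset_Ioc_self).continuousAt (isOpen_Ioo.mem_nhds hxab)
    exact intervalIntegral.integral_hasDerivAt_left hint hmeas hcont
  -- G = -2√W
  set G : ℝ → ℝ := fun x => -(2 * Real.sqrt (W x)) with hG
  have hGcont : ContinuousOn G (Icc t b) :=
    (continuousOn_const.mul (Real.continuous_sqrt.comp_continuousOn hWcont)).neg
  have hGderiv : ∀ x ∈ Ioo t b, HasDerivAt G (ω x / Real.sqrt (W x)) x := by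
    intro x hx
    have hpos : W x ≠ 0 := (hWpos x ⟨hx.1.le, hx.2⟩).ne'
    have h1 : HasDerivAt (fun y => Real.sqrt (W y)) (-ω x / (2 * Real.sqrt (W x))) x :=
      (hWderiv x hx).sqrt hpos
    have h2 := (h1.const_mul (2 : ℝ)).neg
    refine h2.congr_deriv ?_
    rw [← mul_div_assoc, mul_div_mul_left _ _ (two_ne_zero' ℝ), neg_div, neg_neg]
  have hnonneg : ∀ x ∈ Ioo t b, 0 ≤ ω x / Real.sqrt (W x) := fun x hx =>
    div_nonneg (hω0 x ⟨ht.1.trans hx.1, hx.2⟩).le (Real.sqrt_nonneg _)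
  have hInt : IntegrableOn (fun x => ω x / Real.sqrt (W x)) (Ioc t b) volume :=
    intervalIntegral.integrableOn_deriv_of_nonneg hGcont hGderiv hnonneg
  refine ⟨hInt, ?_⟩
  have hII : IntervalIntegrable (fun x => ω x / Real.sqrt (W x)) volume t b :=
    (intervalIntegrable_iff_integrableOn_Ioc_of_le htb).mpr hInt
  rw [intervalIntegral.integral_eq_sub_of_hasDerivAt_of_le htb hGcont hGderiv hII]
  simp [hG, hW, intervalIntegral.integral_same]


/-- Pointwise Cauchy–Schwarz with the auxiliary weight `φ^{1/4}`:
`u(x)² ≤ 2√φ(x) · ∫_a^x g² √φ / v` (as an `ℝ≥0∞` inequality, no integrability needed). [folklore] -/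
private theorem pointwise_cs {a b : ℝ} {v g : ℝ → ℝ} (hv : ContinuousOn v (Icc a b))
    (hv0 : ∀ t ∈ Ioo a b, 0 < v t) (hg : ContinuousOn g (Icc a b)) {x : ℝ} (hx : x ∈ Ioc a b) :
    ENNReal.ofReal ((∫ t in a..x, g t) ^ 2) ≤
      ENNReal.ofReal (2 * Real.sqrt (∫ s in a..x, v s)) *
        ∫⁻ t in Ioo a x, ENNReal.ofReal (g t ^ 2 * Real.sqrt (∫ s in a..t, v s) / v t) := by
  set φ : ℝ → ℝ := fun t => ∫ s in a..t, v s with hφ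
  have hax : a ≤ x := hx.1.le
  have hφpos : ∀ t ∈ Ioc a x, 0 < φ t := by
    intro t ht
    have hvt : ContinuousOn v (Icc a t) := hv.mono (Icc_subset_Icc_right (ht.2.trans hx.2))
    exact intervalIntegral.intervalIntegral_pos_of_pos_on (hvt.intervalIntegrable_of_Icc ht.1.le)
      (fun s hs => hv0 s ⟨hs.1, hs.2.trans_le (ht.2.trans hx.2)⟩) ht.1
  have hφcontb : ContinuousOn φ (Icc a b) := by
    have hint : IntegrableOn v (uIcc a b) volume := by
      rw [uIcc_of_le (hax.trans hx.2)]
      exact hv.integrableOn_compact isCompact_Icc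
    have := intervalIntegral.continuousOn_primitive_interval (μ := volume) hint
    rwa [uIcc_of_le (hax.trans hx.2)] at this
  -- the two factors
  set F : ℝ → ℝ≥0∞ := fun t =>
    ENNReal.ofReal (|g t| * Real.sqrt (Real.sqrt (φ t)) / Real.sqrt (v t)) with hF
  set G : ℝ → ℝ≥0∞ := fun t => ENNReal.ofReal (Real.sqrt (v t) / Real.sqrt (Real.sqrt (φ t))) with hG
  have hIoo_sub : Ioo a x ⊆ Icc a b := fun t ht => ⟨ht.1.le, ht.2.le.trans hx.2⟩
  -- measurability on Ioo a x
  have hvI : ContinuousOn v (Ioo a x) := hv.mono hIoo_sub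
  have hgI : ContinuousOn g (Ioo a x) := hg.mono hIoo_sub
  have hφI : ContinuousOn φ (Ioo a x) := hφcontb.mono hIoo_sub
  have hFm : AEMeasurable F (volume.restrict (Ioo a x)) := by
    refine (ContinuousOn.aemeasurable ?_ measurableSet_Ioo).ennreal_ofReal
    refine ContinuousOn.div (hgI.abs.mul ((Real.continuous_sqrt.comp_continuousOn
      (Real.continuous_sqrt.comp_continuousOn hφI)))) (Real.continuous_sqrt.comp_continuousOn hvI) ?_
    intro t ht; exact Real.sqrt_ne_zero'.mpr (hv0 t ⟨ht.1, ht.2.trans_le hx.2⟩)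
  have hGm : AEMeasurable G (volume.restrict (Ioo a x)) := by
    refine (ContinuousOn.aemeasurable ?_ measurableSet_Ioo).ennreal_ofReal
    refine ContinuousOn.div (Real.continuous_sqrt.comp_continuousOn hvI)
      (Real.continuous_sqrt.comp_continuousOn (Real.continuous_sqrt.comp_continuousOn hφI)) ?_
    intro t ht
    exact Real.sqrt_ne_zero'.mpr (Real.sqrt_pos.mpr (hφpos t ⟨ht.1, ht.2.le⟩))
  -- F * G = ofReal |g| on Ioo a x
  have hFG : ∀ t ∈ Ioo a x, (F * G) t = ENNReal.ofReal (|g t|) := by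
    intro t ht
    have hv' : 0 < Real.sqrt (v t) := Real.sqrt_pos.mpr (hv0 t ⟨ht.1, ht.2.trans_le hx.2⟩)
    have hφ' : 0 < Real.sqrt (Real.sqrt (φ t)) :=
      Real.sqrt_pos.mpr (Real.sqrt_pos.mpr (hφpos t ⟨ht.1, ht.2.le⟩))
    simp only [Pi.mul_apply, hF, hG]
    rw [← ENNReal.ofReal_mul (by positivity)]
    congr 1
    field_simp
  -- step 1: |u x| ≤ ∫ |g| = ∫⁻ F G
  have hgint : IntervalIntegrable g volume a x :=
    (hg.mono (Icc_subset_Icc_right hx.2)).intervalIntegrable_of_Icc hax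
  have h1 : ENNReal.ofReal (|∫ t in a..x, g t|) ≤ ∫⁻ t in Ioo a x, (F * G) t := by
    have hle : |∫ t in a..x, g t| ≤ ∫ t in a..x, |g t| := by
      simpa only [Real.norm_eq_abs] using intervalIntegral.norm_integral_le_integral_norm (f := g) hax
    refine (ENNReal.ofReal_le_ofReal hle).trans ?_
    rw [intervalIntegral.integral_of_le hax,
      ofReal_integral_eq_lintegral_ofReal hgint.abs.1 (ae_of_all _ fun t => abs_nonneg (g t))]
    rw [← setLIntegral_congr Ioo_ae_eq_Ioc]  -- switch Ioc → Ioo? direction check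
    exact (setLIntegral_congr_fun measurableSet_Ioo fun t ht => (hFG t ht).symm).le
  -- Hölder
  have h2 : ∫⁻ t in Ioo a x, (F * G) t ≤
      (∫⁻ t in Ioo a x, F t ^ (2:ℝ)) ^ (1/2:ℝ) * (∫⁻ t in Ioo a x, G t ^ (2:ℝ)) ^ (1/2:ℝ) := by
    have := ENNReal.lintegral_mul_le_Lp_mul_Lq (volume.restrict (Ioo a x))
      Real.HolderConjugate.two_two hFm hGm
    simpa using this
  -- ∫ G² = 2√φ(x)
  have hG2 : ∫⁻ t in Ioo a x, G t ^ (2:ℝ) = ENNReal.ofReal (2 * Real.sqrt (φ x)) := by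
    have hA := ftc_left hv hv0 hx
    have hcongr : ∫⁻ t in Ioo a x, G t ^ (2:ℝ) =
        ∫⁻ t in Ioo a x, ENNReal.ofReal (v t / Real.sqrt (φ t)) := by
      refine setLIntegral_congr_fun measurableSet_Ioo fun t ht => ?_
      have hv' : 0 ≤ v t := (hv0 t ⟨ht.1, ht.2.trans_le hx.2⟩).le
      have hφ' : 0 < φ t := hφpos t ⟨ht.1, ht.2.le⟩
      simp only [hG]
      rw [ENNReal.rpow_two, ← ENNReal.ofReal_pow (by positivity)]
      congr 1
      rw [div_pow, Real.sq_sqrt hv', Real.sq_sqrt (Real.sqrt_nonneg _)]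
    have hvnn := nonneg_of_pos_Ioo (hx.1.trans_le hx.2) hv hv0
    rw [hcongr, setLIntegral_congr Ioo_ae_eq_Ioc, ← ofReal_integral_eq_lintegral_ofReal hA.1
      (ae_restrict_of_forall_mem measurableSet_Ioc fun t ht =>
        div_nonneg (hvnn t ⟨ht.1.le, ht.2.trans hx.2⟩) (Real.sqrt_nonneg _)),
      ← intervalIntegral.integral_of_le hax, hA.2]
  -- ∫ F² = the weighted integral
  have hF2 : ∫⁻ t in Ioo a x, F t ^ (2:ℝ) =
      ∫⁻ t in Ioo a x, ENNReal.ofReal (g t ^ 2 * Real.sqrt (φ t) / v t) := by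
    refine setLIntegral_congr_fun measurableSet_Ioo fun t ht => ?_
    have hv' : 0 < v t := hv0 t ⟨ht.1, ht.2.trans_le hx.2⟩
    have hφ' : 0 < φ t := hφpos t ⟨ht.1, ht.2.le⟩
    simp only [hF]
    rw [ENNReal.rpow_two, ← ENNReal.ofReal_pow (by positivity)]
    congr 1
    rw [div_pow, mul_pow, sq_abs, Real.sq_sqrt hv'.le, Real.sq_sqrt (Real.sqrt_nonneg _)]
  -- combine and square
  have h3 : ENNReal.ofReal (|∫ t in a..x, g t|) ≤
      (∫⁻ t in Ioo a x, ENNReal.ofReal (g t ^ 2 * Real.sqrt (φ t) / v t)) ^ (1/2:ℝ) *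
        (ENNReal.ofReal (2 * Real.sqrt (φ x))) ^ (1/2:ℝ) := by
    have := h1.trans h2
    rwa [hF2, hG2] at this
  have hsq : ENNReal.ofReal ((∫ t in a..x, g t) ^ 2) = ENNReal.ofReal (|∫ t in a..x, g t|) ^ 2 := by
    rw [← sq_abs, ENNReal.ofReal_pow (abs_nonneg _)]
  rw [hsq]
  calc ENNReal.ofReal (|∫ t in a..x, g t|) ^ 2
      ≤ ((∫⁻ t in Ioo a x, ENNReal.ofReal (g t ^ 2 * Real.sqrt (φ t) / v t)) ^ (1/2:ℝ) *
          (ENNReal.ofReal (2 * Real.sqrt (φ x))) ^ (1/2:ℝ)) ^ 2 := by gcongr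
    _ = (∫⁻ t in Ioo a x, ENNReal.ofReal (g t ^ 2 * Real.sqrt (φ t) / v t)) *
          ENNReal.ofReal (2 * Real.sqrt (φ x)) := by
        rw [mul_pow, ← ENNReal.rpow_natCast, ← ENNReal.rpow_natCast, ← ENNReal.rpow_mul,
          ← ENNReal.rpow_mul]
        norm_num
    _ = _ := by rw [mul_comm]

/-- Tail bound: `∫_t^b 2ω√φ ≤ 4 √B √W(t)` under the Muckenhoupt condition `φ·W ≤ B` on `(a,b)`. [folklore] -/
private theorem tail_bound {a b : ℝ} {v ω : ℝ → ℝ} (hv : ContinuousOn v (Icc a b))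
    (hv0 : ∀ t ∈ Ioo a b, 0 < v t) (hω : ContinuousOn ω (Ioc a b)) (hω0 : ∀ x ∈ Ioo a b, 0 < ω x)
    {B : ℝ} (hB : ∀ x ∈ Ioo a b, (∫ s in a..x, v s) * (∫ s in x..b, ω s) ≤ B)
    {t : ℝ} (ht : t ∈ Ioo a b) :
    ∫⁻ x in Ioo t b, ENNReal.ofReal (2 * Real.sqrt (∫ s in a..x, v s) * ω x) ≤
      ENNReal.ofReal (4 * Real.sqrt B * Real.sqrt (∫ s in t..b, ω s)) := by
  set φ : ℝ → ℝ := fun x => ∫ s in a..x, v s with hφ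
  set W : ℝ → ℝ := fun x => ∫ s in x..b, ω s with hW
  have htb : t ≤ b := ht.2.le
  have hab : a < b := ht.1.trans ht.2
  have hBW := ftc_right hω hω0 ht
  have hvnn := nonneg_of_pos_Ioo hab hv hv0
  have hWpos : ∀ x ∈ Ico t b, 0 < W x := by
    intro x hx
    have hωx : ContinuousOn ω (Icc x b) :=
      hω.mono fun y hy => ⟨(ht.1.trans_le hx.1).trans_le hy.1, hy.2⟩
    exact intervalIntegral.intervalIntegral_pos_of_pos_on (hωx.intervalIntegrable_of_Icc hx.2.le)
      (fun s hs => hω0 s ⟨(ht.1.trans_le hx.1).trans hs.1, hs.2⟩) hx.2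
  have hφnn : ∀ x ∈ Icc t b, 0 ≤ φ x := fun x hx =>
    intervalIntegral.integral_nonneg (ht.1.le.trans hx.1) fun s hs =>
      hvnn s ⟨hs.1, hs.2.trans hx.2⟩
  have hBnn : 0 ≤ B :=
    le_trans (mul_nonneg (hφnn t ⟨le_rfl, htb⟩) (hWpos t ⟨le_rfl, ht.2⟩).le) (hB t ht)
  -- pointwise comparison on Ioo t b
  have hpt : ∀ x ∈ Ioo t b,
      2 * Real.sqrt (φ x) * ω x ≤ 2 * Real.sqrt B * (ω x / Real.sqrt (W x)) := by
    intro x hx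
    have hxab : x ∈ Ioo a b := ⟨ht.1.trans hx.1, hx.2⟩
    have hWx : 0 < W x := hWpos x ⟨hx.1.le, hx.2⟩
    have hsW : 0 < Real.sqrt (W x) := Real.sqrt_pos.mpr hWx
    have hωx : 0 ≤ ω x := (hω0 x hxab).le
    have key : Real.sqrt (φ x) * Real.sqrt (W x) ≤ Real.sqrt B := by
      rw [← Real.sqrt_mul (hφnn x ⟨hx.1.le, hx.2.le⟩)]
      exact Real.sqrt_le_sqrt (hB x hxab)
    have key2 : Real.sqrt (φ x) ≤ Real.sqrt B / Real.sqrt (W x) := by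
      rwa [le_div_iff₀ hsW]
    calc 2 * Real.sqrt (φ x) * ω x = 2 * ω x * Real.sqrt (φ x) := by ring
      _ ≤ 2 * ω x * (Real.sqrt B / Real.sqrt (W x)) := by gcongr
      _ = 2 * Real.sqrt B * (ω x / Real.sqrt (W x)) := by ring
  -- integrate
  have hInt2 : IntegrableOn (fun x => 2 * Real.sqrt B * (ω x / Real.sqrt (W x))) (Ioc t b) volume :=
    hBW.1.const_mul _
  calc ∫⁻ x in Ioo t b, ENNReal.ofReal (2 * Real.sqrt (φ x) * ω x)
      ≤ ∫⁻ x in Ioo t b, ENNReal.ofReal (2 * Real.sqrt B * (ω x / Real.sqrt (W x))) :=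
        lintegral_mono_ae ((ae_restrict_iff' measurableSet_Ioo).mpr (ae_of_all _ fun x hx =>
          ENNReal.ofReal_le_ofReal (hpt x hx)))
    _ = ∫⁻ x in Ioc t b, ENNReal.ofReal (2 * Real.sqrt B * (ω x / Real.sqrt (W x))) :=
        setLIntegral_congr Ioo_ae_eq_Ioc
    _ = ENNReal.ofReal (∫ x in Ioc t b, 2 * Real.sqrt B * (ω x / Real.sqrt (W x))) := by
        rw [ofReal_integral_eq_lintegral_ofReal hInt2]
        exact ae_restrict_of_forall_mem measurableSet_Ioc fun x hx =>
          mul_nonneg (by positivity) (div_nonneg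
            (nonneg_of_pos_Ioo' hab hω hω0 x ⟨ht.1.trans hx.1, hx.2⟩) (Real.sqrt_nonneg _))
    _ = ENNReal.ofReal (4 * Real.sqrt B * Real.sqrt (W t)) := by
        rw [← intervalIntegral.integral_of_le htb, intervalIntegral.integral_const_mul, hBW.2]
        congr 1
        ring

/-- **The one-dimensional weighted Hardy inequality (Muckenhoupt's criterion, case `p = q = 2`,
sufficiency, constant `4`).** Let `a, b ∈ ℝ`, `v` continuous on `[a, b]` and positive on `(a, b)`
(the reciprocal weight `v = 1/w₁`), `ω` continuous on `(a, b]` and positive on `(a, b)` (it may blow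
up at `a`), `g` continuous on `[a, b]`, `u(x) = ∫ₐˣ g` (so `u(a) = 0`). If
`B(x)² := (∫ₓᵇ ω)·(∫ₐˣ v) ≤ B` for all `x ∈ (a, b)` — Muckenhoupt's condition, as printed in
Drábek–Kufner–Nicolosi, Example 1.4, (1.36)–(1.37) with `p = q = 2`, `w₁^{1-p'} = 1/w₁ = v` — then
`∫ₐᵇ u² ω ≤ 4 B ∫ₐᵇ g²/v`, i.e. (1.34) with the constant `c = 2B^{1/2}` of Muckenhoupt's Theorem 1
(`p^{1/p}(p')^{1/p'} B = 2B^{1/2}` for `p = 2`). Both sides are stated as lower Lebesgue integrals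
(`ℝ≥0∞`), so no integrability hypothesis is needed; for `b ≤ a` the statement is trivial.
Proof as printed (Cauchy–Schwarz with the auxiliary weight `φ^{1/4}`, `φ(x) = ∫ₐˣ v`, Tonelli, and
the two primitives `2√φ`, `-2√W`, `W(x) = ∫ₓᵇ ω`).
[cite: Muckenhoupt1972, Thm. 1 (case p = 2, sufficiency)]
[cite: DrabekKufnerNicolosi1997, Example 1.4, (1.34)–(1.37)] -/
theorem weightedHardy {a b : ℝ} {v ω g : ℝ → ℝ} (hv : ContinuousOn v (Icc a b))
    (hv0 : ∀ t ∈ Ioo a b, 0 < v t) (hω : ContinuousOn ω (Ioc a b)) (hω0 : ∀ x ∈ Ioo a b, 0 < ω x)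
    (hg : ContinuousOn g (Icc a b)) {B : ℝ}
    (hB : ∀ x ∈ Ioo a b, (∫ s in a..x, v s) * (∫ s in x..b, ω s) ≤ B) :
    ∫⁻ x in Ioo a b, ENNReal.ofReal ((∫ t in a..x, g t) ^ 2 * ω x) ≤
      ENNReal.ofReal (4 * B) * ∫⁻ t in Ioo a b, ENNReal.ofReal (g t ^ 2 / v t) := by
  rcases le_or_gt b a with hba | hab
  · simp [Ioo_eq_empty_of_le hba]
  set φ : ℝ → ℝ := fun x => ∫ s in a..x, v s with hφ
  set W : ℝ → ℝ := fun x => ∫ s in x..b, ω s with hW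
  set S : Set ℝ := Ioo a b with hS
  have hvnn := nonneg_of_pos_Ioo hab hv hv0
  -- the two kernels
  set A : ℝ → ℝ≥0∞ := fun x => ENNReal.ofReal (2 * Real.sqrt (φ x) * ω x) with hA
  set I : ℝ → ℝ≥0∞ := fun t => ENNReal.ofReal (g t ^ 2 * Real.sqrt (φ t) / v t) with hI
  have hφcont : ContinuousOn φ (Icc a b) := by
    have hint : IntegrableOn v (uIcc a b) volume := by
      rw [uIcc_of_le hab.le]; exact hv.integrableOn_compact isCompact_Icc
    have := intervalIntegral.continuousOn_primitive_interval (μ := volume) hint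
    rwa [uIcc_of_le hab.le] at this
  have hφS : ContinuousOn φ S := hφcont.mono Ioo_subset_Icc_self
  have hAm : AEMeasurable A (volume.restrict S) := by
    refine (ContinuousOn.aemeasurable ?_ measurableSet_Ioo).ennreal_ofReal
    exact (continuousOn_const.mul (Real.continuous_sqrt.comp_continuousOn hφS)).mul
      (hω.mono Ioo_subset_Ioc_self)
  have hIm : AEMeasurable I (volume.restrict S) := by
    refine (ContinuousOn.aemeasurable ?_ measurableSet_Ioo).ennreal_ofReal
    refine ContinuousOn.div (((hg.mono Ioo_subset_Icc_self).pow 2).mul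
      (Real.continuous_sqrt.comp_continuousOn hφS)) (hv.mono Ioo_subset_Icc_self) ?_
    exact fun t ht => (hv0 t ht).ne'
  -- Step 1: pointwise bound of the integrand
  have step1 : ∀ x ∈ S, ENNReal.ofReal ((∫ t in a..x, g t) ^ 2 * ω x) ≤
      A x * ∫⁻ t in Ioo a x, I t := by
    intro x hx
    have hωx : 0 ≤ ω x := (hω0 x hx).le
    have hcs := pointwise_cs hv hv0 hg ⟨hx.1, hx.2.le⟩
    rw [ENNReal.ofReal_mul' hωx]
    calc ENNReal.ofReal ((∫ t in a..x, g t) ^ 2) * ENNReal.ofReal (ω x)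
        ≤ (ENNReal.ofReal (2 * Real.sqrt (φ x)) * ∫⁻ t in Ioo a x, I t) * ENNReal.ofReal (ω x) := by
          gcongr
      _ = A x * ∫⁻ t in Ioo a x, I t := by
          simp only [hA]
          rw [ENNReal.ofReal_mul' hωx]
          ring
  -- Step 2: Tonelli
  set K : ℝ → ℝ → ℝ≥0∞ := fun x t => if t < x then A x * I t else 0 with hK
  have hKm : AEMeasurable (Function.uncurry K)
      ((volume.restrict S).prod (volume.restrict S)) := by
    have h1 : AEMeasurable (fun p : ℝ × ℝ => A p.1 * I p.2)
        ((volume.restrict S).prod (volume.restrict S)) :=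
      (hAm.comp_quasiMeasurePreserving Measure.quasiMeasurePreserving_fst).mul
        (hIm.comp_quasiMeasurePreserving Measure.quasiMeasurePreserving_snd)
    have hset : MeasurableSet {p : ℝ × ℝ | p.2 < p.1} := measurableSet_lt measurable_snd measurable_fst
    have : Function.uncurry K = {p : ℝ × ℝ | p.2 < p.1}.indicator (fun p => A p.1 * I p.2) := by
      funext p
      simp only [Function.uncurry, hK, Set.indicator, Set.mem_setOf_eq]
    rw [this]
    exact h1.indicator hset
  have inner_x : ∀ x ∈ S, ∫⁻ t in S, K x t = A x * ∫⁻ t in Ioo a x, I t := by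
    intro x hx
    have : (fun t => K x t) = (Iio x).indicator (fun t => A x * I t) := by
      funext t; simp only [hK, Set.indicator, Set.mem_Iio]
    rw [this, lintegral_indicator measurableSet_Iio, Measure.restrict_restrict measurableSet_Iio]
    have hset : Iio x ∩ S = Ioo a x := by
      ext t; simp only [hS, mem_inter_iff, mem_Iio, mem_Ioo]
      constructor
      · rintro ⟨h1, h2, _⟩; exact ⟨h2, h1⟩
      · rintro ⟨h1, h2⟩; exact ⟨h2, h1, h2.trans hx.2⟩
    rw [hset, lintegral_const_mul' _ _ ENNReal.ofReal_ne_top]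
  have inner_t : ∀ t ∈ S, ∫⁻ x in S, K x t = I t * ∫⁻ x in Ioo t b, A x := by
    intro t ht
    have : (fun x => K x t) = (Ioi t).indicator (fun x => A x * I t) := by
      funext x; simp only [hK, Set.indicator, Set.mem_Ioi]
    rw [this, lintegral_indicator measurableSet_Ioi, Measure.restrict_restrict measurableSet_Ioi]
    have hset : Ioi t ∩ S = Ioo t b := by
      ext x; simp only [hS, mem_inter_iff, mem_Ioi, mem_Ioo]
      constructor
      · rintro ⟨h1, _, h3⟩; exact ⟨h1, h3⟩
      · rintro ⟨h1, h2⟩; exact ⟨h1, ht.1.trans h1, h2⟩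
    rw [hset, lintegral_mul_const' _ _ ENNReal.ofReal_ne_top, mul_comm]
  have tonelli : ∫⁻ x in S, A x * ∫⁻ t in Ioo a x, I t = ∫⁻ t in S, I t * ∫⁻ x in Ioo t b, A x := by
    calc ∫⁻ x in S, A x * ∫⁻ t in Ioo a x, I t = ∫⁻ x in S, ∫⁻ t in S, K x t :=
          setLIntegral_congr_fun measurableSet_Ioo fun x hx => (inner_x x hx).symm
      _ = ∫⁻ t in S, ∫⁻ x in S, K x t := lintegral_lintegral_swap hKm
      _ = ∫⁻ t in S, I t * ∫⁻ x in Ioo t b, A x :=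
          setLIntegral_congr_fun measurableSet_Ioo fun t ht => inner_t t ht
  -- Step 3: tail bound and the final pointwise estimate
  have step3 : ∀ t ∈ S, I t * ∫⁻ x in Ioo t b, A x ≤
      ENNReal.ofReal (4 * B) * ENNReal.ofReal (g t ^ 2 / v t) := by
    intro t ht
    have htail := tail_bound hv hv0 hω hω0 hB ht
    have hvt : 0 < v t := hv0 t ht
    have hφt : 0 ≤ φ t := intervalIntegral.integral_nonneg ht.1.le fun s hs =>
      hvnn s ⟨hs.1, hs.2.trans ht.2.le⟩
    have hWt : 0 ≤ W t := intervalIntegral.integral_nonneg ht.2.le fun s hs =>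
      nonneg_of_pos_Ioo' hab hω hω0 s ⟨ht.1.trans_le hs.1, hs.2⟩
    have hBt : 0 ≤ B := le_trans (mul_nonneg hφt hWt) (hB t ht)
    have key : Real.sqrt (φ t) * Real.sqrt (W t) ≤ Real.sqrt B := by
      rw [← Real.sqrt_mul hφt]; exact Real.sqrt_le_sqrt (hB t ht)
    calc I t * ∫⁻ x in Ioo t b, A x
        ≤ I t * ENNReal.ofReal (4 * Real.sqrt B * Real.sqrt (W t)) := by gcongr
      _ = ENNReal.ofReal (g t ^ 2 / v t * (4 * (Real.sqrt (φ t) * Real.sqrt (W t)) * Real.sqrt B)) := by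
          simp only [hI]
          rw [← ENNReal.ofReal_mul (by positivity)]
          congr 1
          have hvne : v t ≠ 0 := hvt.ne'
          field_simp
      _ ≤ ENNReal.ofReal (g t ^ 2 / v t * (4 * Real.sqrt B * Real.sqrt B)) := by
          apply ENNReal.ofReal_le_ofReal
          have h0 : 0 ≤ g t ^ 2 / v t := by positivity
          have : 4 * (Real.sqrt (φ t) * Real.sqrt (W t)) * Real.sqrt B ≤ 4 * Real.sqrt B * Real.sqrt B := by
            nlinarith [Real.sqrt_nonneg B, Real.sqrt_nonneg (φ t), Real.sqrt_nonneg (W t)]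
          exact mul_le_mul_of_nonneg_left this h0
      _ = ENNReal.ofReal (4 * B) * ENNReal.ofReal (g t ^ 2 / v t) := by
          rw [mul_assoc, Real.mul_self_sqrt hBt, mul_comm (g t ^ 2 / v t),
            ENNReal.ofReal_mul (by positivity)]
  -- assemble
  calc ∫⁻ x in S, ENNReal.ofReal ((∫ t in a..x, g t) ^ 2 * ω x)
      ≤ ∫⁻ x in S, A x * ∫⁻ t in Ioo a x, I t :=
        lintegral_mono_ae ((ae_restrict_iff' measurableSet_Ioo).mpr (ae_of_all _ step1))
    _ = ∫⁻ t in S, I t * ∫⁻ x in Ioo t b, A x := tonelli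
    _ ≤ ∫⁻ t in S, ENNReal.ofReal (4 * B) * ENNReal.ofReal (g t ^ 2 / v t) :=
        lintegral_mono_ae ((ae_restrict_iff' measurableSet_Ioo).mpr (ae_of_all _ step3))
    _ = ENNReal.ofReal (4 * B) * ∫⁻ t in S, ENNReal.ofReal (g t ^ 2 / v t) :=
        lintegral_const_mul' _ _ ENNReal.ofReal_ne_top


end Literature.Analysis.Calculus

end
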